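import Mathlib

/-!
# Route «KPlusLogSqLaw», crux `WeakLifting` (stmt-ValiantsHypothesis-19561) — α register / Lift line:
# the DEFINITE ZONE of a PSD-lettered pencil against its pivot letter is an interval

HONEST FRAMING.  Helper file (`--supports stmt-ValiantsHypothesis-19561 --as helper`), seat val-sym-lift-p2 (g12), cell `pub-symmetroid`,
2026-08-28.  Elementary convexity; nothing here bounds a root count; nothing bears on `WeakLifting`, `TropicalB`, Conjecture B, Door-A,
`MatrixDescartes` (stmt-ValiantsHypothesis-18050) or VP ≠ VNP.

WHAT IS PROVED.  Let `Pₖ ⪰ 0` (`k < K`) be real positive semidefinite `m × m` letters with exponents `dₖ`, and `N` ANY real symmetric letter with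
exponent `e` (the «pivot»).  For `0 < x ≤ y ≤ z`: if `x^e N − ∑ₖ x^{dₖ} Pₖ ≻ 0` and `z^e N − ∑ₖ z^{dₖ} Pₖ ≻ 0` then `y^e N − ∑ₖ y^{dₖ} Pₖ ≻ 0`
(`posDef_pivot_sub_of_mem_Icc`).  In words: the set of `x > 0` at which the lacunary pencil `F(x) = ∑ₖ x^{dₖ} Pₖ − x^e N` is NEGATIVE DEFINITE
(the pivot dominates) is order-connected — an interval.  Mechanism: for each test vector `u`, `uᵀF(x)u / x^e = ∑ₖ x^{dₖ−e}(uᵀPₖu) − uᵀNu` is a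
Laurent polynomial in `x` with non-negative coefficients minus a constant, hence CONVEX on `(0, ∞)` (Mathlib `convexOn_zpow`); a convex function below a
constant at `x` and `z` is below it in between.  No sign hypothesis on `N`; with `N ≻ 0` this is the top zone of the definite-pivot sector studied in
`…KPlusLogSqLawDefinitePivotUnfolding` (rank unfolding, p602364), i.e. of the lineage's frame `det(E(t) − A)`: there it says the excursion set
`{t : E(t) ≻ A}`… (dually `{P(t) ≺ I}` for `P(t) = ∑ e^{μᵢt} vᵢvᵢᵀ`) is one interval, so the top eigenvalue sheet carries at most two zeros.
The opposite zone `{F(x) ≻ 0}` is NOT an interval in general (already for `m = 1`: `x^{d₁} + x^{d₂} − x^e`, `d₁ < e < d₂`).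

[folklore] Convexity of `x ↦ x^q` (`q ∈ ℤ`) on `(0, ∞)`.
-/

-- `Summit.ValiantsHypothesis.ValiantsHypothesis.…` repeats a component by the D-0017 layout
-- (single-conjunct summit), which the `dupNamespace` linter flags; the name is mandated.
set_option linter.dupNamespace false
set_option autoImplicit false

namespace Summit.ValiantsHypothesis.ValiantsHypothesis.Theorems.KPlusLogSqLaw.DefinitePivot

open Matrix Finset
open scoped BigOperators

variable {m K : ℕ}

/-- the quadratic form of `x^e N − ∑ₖ x^{dₖ} Pₖ` at a real vector. [folklore] -/
theorem dotProduct_pivotSub_mulVec (P : Fin K → Matrix (Fin m) (Fin m) ℝ) (N : Matrix (Fin m) (Fin m) ℝ)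
    (d : Fin K → ℕ) (e : ℕ) (x : ℝ) (u : Fin m → ℝ) :
    u ⬝ᵥ ((x ^ e • N - ∑ k, x ^ d k • P k) *ᵥ u) =
      x ^ e * (u ⬝ᵥ (N *ᵥ u)) - ∑ k, x ^ d k * (u ⬝ᵥ (P k *ᵥ u)) := by
  rw [Matrix.sub_mulVec, dotProduct_sub, Matrix.smul_mulVec, dotProduct_smul, Matrix.sum_mulVec,
    dotProduct_sum]
  simp only [Matrix.smul_mulVec, dotProduct_smul, smul_eq_mul]

/-- symmetry of `x^e N − ∑ₖ x^{dₖ} Pₖ` for symmetric letters. [folklore] -/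
theorem isHermitian_pivotSub (P : Fin K → Matrix (Fin m) (Fin m) ℝ) (hP : ∀ k, (P k).IsHermitian)
    (N : Matrix (Fin m) (Fin m) ℝ) (hN : N.IsSymm) (d : Fin K → ℕ) (e : ℕ) (x : ℝ) :
    (x ^ e • N - ∑ k, x ^ d k • P k).IsHermitian := by
  have hNh : N.IsHermitian := by
    unfold Matrix.IsHermitian
    rw [conjTranspose_eq_transpose_of_trivial]
    exact hN
  unfold Matrix.IsHermitian at hNh hP ⊢
  rw [conjTranspose_sub, conjTranspose_smul, conjTranspose_sum, hNh, star_trivial]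
  congr 1
  refine Finset.sum_congr rfl fun k _ => ?_
  rw [conjTranspose_smul, hP k, star_trivial]

/-- Laurent rewriting: `∑ₖ s^{dₖ} bₖ = s^e · ∑ₖ s^{dₖ − e} bₖ` (integer powers, `s ≠ 0`). [folklore] -/
theorem sum_pow_mul_eq_pow_mul_sum_zpow (d : Fin K → ℕ) (e : ℕ) (b : Fin K → ℝ) {s : ℝ} (hs : s ≠ 0) :
    ∑ k, s ^ d k * b k = s ^ e * ∑ k, s ^ ((d k : ℤ) - e) * b k := by
  rw [Finset.mul_sum]
  refine Finset.sum_congr rfl fun k _ => ?_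
  rw [← mul_assoc, zpow_sub₀ hs, zpow_natCast, zpow_natCast, mul_div_cancel₀ _ (pow_ne_zero _ hs)]

/-- **THE NEGATIVE-DEFINITE ZONE IS AN INTERVAL.**  `Pₖ ⪰ 0`, `N` symmetric, `0 < x ≤ y ≤ z`:
`x^e N − ∑ x^{dₖ}Pₖ ≻ 0` and `z^e N − ∑ z^{dₖ}Pₖ ≻ 0` imply `y^e N − ∑ y^{dₖ}Pₖ ≻ 0`. [folklore] -/
theorem posDef_pivotSub_of_mem_Icc (P : Fin K → Matrix (Fin m) (Fin m) ℝ) (hP : ∀ k, (P k).PosSemidef)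
    (N : Matrix (Fin m) (Fin m) ℝ) (hN : N.IsSymm) (d : Fin K → ℕ) (e : ℕ) {x y z : ℝ}
    (hx : 0 < x) (hxy : x ≤ y) (hyz : y ≤ z)
    (hFx : (x ^ e • N - ∑ k, x ^ d k • P k).PosDef) (hFz : (z ^ e • N - ∑ k, z ^ d k • P k).PosDef) :
    (y ^ e • N - ∑ k, y ^ d k • P k).PosDef := by
  have hy : 0 < y := lt_of_lt_of_le hx hxy
  have hz : 0 < z := lt_of_lt_of_le hy hyz
  refine PosDef.of_dotProduct_mulVec_pos (isHermitian_pivotSub P (fun k => (hP k).1) N hN d e y) fun u hu => ?_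
  have hxq := hFx.dotProduct_mulVec_pos hu
  have hzq := hFz.dotProduct_mulVec_pos hu
  rw [star_trivial] at hxq hzq ⊢
  rw [dotProduct_pivotSub_mulVec] at hxq hzq ⊢
  set a : ℝ := u ⬝ᵥ (N *ᵥ u) with ha
  set b : Fin K → ℝ := fun k => u ⬝ᵥ (P k *ᵥ u) with hb
  have hb0 : ∀ k, 0 ≤ b k := fun k => by
    have h := (hP k).dotProduct_mulVec_nonneg u
    rwa [star_trivial] at h
  -- the convex function g(s) = ∑ₖ s^{dₖ − e} bₖ is below a at x and at z
  have hg : ∀ s : ℝ, 0 < s → (0 < s ^ e * a - ∑ k, s ^ d k * b k ↔ ∑ k, s ^ ((d k : ℤ) - e) * b k < a) := by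
    intro s hs
    rw [sum_pow_mul_eq_pow_mul_sum_zpow d e b hs.ne', ← mul_sub, mul_pos_iff_of_pos_left (pow_pos hs e), sub_pos]
  change 0 < x ^ e * a - ∑ k, x ^ d k * b k at hxq
  change 0 < z ^ e * a - ∑ k, z ^ d k * b k at hzq
  change 0 < y ^ e * a - ∑ k, y ^ d k * b k
  rw [hg x hx] at hxq
  rw [hg z hz] at hzq
  rw [hg y hy]
  rcases eq_or_lt_of_le (hxy.trans hyz) with hxz | hxz
  · -- x = z forces y = x
    have hyx : y = x := le_antisymm (hxz ▸ hyz) hxy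
    rw [hyx]
    exact hxq
  · -- y = λ x + μ z with λ = (z − y)/(z − x), μ = (y − x)/(z − x)
    have hzx : 0 < z - x := sub_pos.2 hxz
    set lam : ℝ := (z - y) / (z - x) with hlam
    set mu : ℝ := (y - x) / (z - x) with hmu
    have hlam0 : 0 ≤ lam := div_nonneg (sub_nonneg.2 hyz) hzx.le
    have hmu0 : 0 ≤ mu := div_nonneg (sub_nonneg.2 hxy) hzx.le
    have hsum : lam + mu = 1 := by
      rw [hlam, hmu, ← add_div, div_eq_one_iff_eq hzx.ne']
      ring
    have hyeq : lam • x + mu • z = y := by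
      rw [smul_eq_mul, smul_eq_mul, hlam, hmu]
      field_simp
      ring
    have conv : ∀ k, y ^ ((d k : ℤ) - e) ≤ lam * x ^ ((d k : ℤ) - e) + mu * z ^ ((d k : ℤ) - e) := by
      intro k
      have h := (convexOn_zpow ((d k : ℤ) - e)).2 (Set.mem_Ioi.2 hx) (Set.mem_Ioi.2 hz) hlam0 hmu0 hsum
      rw [hyeq] at h
      simpa only [smul_eq_mul] using h
    calc ∑ k, y ^ ((d k : ℤ) - e) * b k
        ≤ ∑ k, (lam * x ^ ((d k : ℤ) - e) + mu * z ^ ((d k : ℤ) - e)) * b k :=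
          Finset.sum_le_sum fun k _ => mul_le_mul_of_nonneg_right (conv k) (hb0 k)
      _ = lam * ∑ k, x ^ ((d k : ℤ) - e) * b k + mu * ∑ k, z ^ ((d k : ℤ) - e) * b k := by
          rw [Finset.mul_sum, Finset.mul_sum, ← Finset.sum_add_distrib]
          refine Finset.sum_congr rfl fun k _ => ?_
          ring
      _ < lam * a + mu * a := by
          rcases eq_or_lt_of_le hlam0 with hl | hl
          · -- lam = 0 ⇒ mu = 1
            have hmu1 : mu = 1 := by linarith
            rw [← hl, hmu1, zero_mul, zero_mul, one_mul, one_mul, zero_add, zero_add]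
            exact hzq
          · have h1 : lam * ∑ k, x ^ ((d k : ℤ) - e) * b k < lam * a := mul_lt_mul_of_pos_left hxq hl
            have h2 : mu * ∑ k, z ^ ((d k : ℤ) - e) * b k ≤ mu * a := mul_le_mul_of_nonneg_left hzq.le hmu0
            linarith
      _ = a := by rw [← add_mul, hsum, one_mul]

/-- the same statement for the pencil itself: the zone where `∑ₖ x^{dₖ}Pₖ − x^e N` is NEGATIVE definite (i.e. its negation is positive
definite) is an interval of `(0, ∞)`. [folklore] -/
theorem negDef_pencil_of_mem_Icc (P : Fin K → Matrix (Fin m) (Fin m) ℝ) (hP : ∀ k, (P k).PosSemidef)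
    (N : Matrix (Fin m) (Fin m) ℝ) (hN : N.IsSymm) (d : Fin K → ℕ) (e : ℕ) {x y z : ℝ}
    (hx : 0 < x) (hxy : x ≤ y) (hyz : y ≤ z)
    (hFx : (-(∑ k, x ^ d k • P k - x ^ e • N)).PosDef) (hFz : (-(∑ k, z ^ d k • P k - z ^ e • N)).PosDef) :
    (-(∑ k, y ^ d k • P k - y ^ e • N)).PosDef := by
  rw [neg_sub] at hFx hFz ⊢
  exact posDef_pivotSub_of_mem_Icc P hP N hN d e hx hxy hyz hFx hFz

end Summit.ValiantsHypothesis.ValiantsHypothesis.Theorems.KPlusLogSqLaw.DefinitePivot
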